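import Summits.QuantumFields.YangMills.Theorems.BalabanLadderUVSeamRecCeilingsFarUVWindowCellLaws
import HarnessLib

/-!
# Crux `UVSeamRec` (stmt-QuantumFields-20043), v5(α) stub `stub_responseMomentsOdd6` (RM), lane B: the far-UV window cell laws in the
# SCHEDULE letters `θ δ : ℝ → ℕ → ℝ` of the v7(β-cl-WCL) candidate's `stub_backgroundFieldWCL`

Helper file (`--supports stmt-QuantumFields-20043`) of the width-lever seat `ym-20043-ceilings-p2` (lane B, gen 4); a repackaging of
`…CeilingsFarUVWindowCellLaws.windowCellLaws_inhabited_farUV` (p563207).  The LEAD's v7(β-cl-WCL) candidate skeleton (ym-spine-20043-p1 g9,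
evidence #50 on 20043, NOT registered) bundles the window cell laws as: thresholds `ε : ℝ → ℕ → ℝ`, weights `θ δ : ℝ → ℕ → ℝ` with
`0 ≤ θ ≤ 1`, `0 ≤ δ ≤ θ¹⁶`, the law `⟨∏_{γ∈A} 1_{largeFieldEvent 𝔟 (ε β k) γ}∘lift⟩_{2L+1,β} ≤ ∏ δ β k` for `β ≥ β₁`, `L ≥ 1`, `k ≥ 1` and window
families, AND the summability `Σ_{1≤k≤kmax β R} θ β k ≤ D`.  `windowCellLaws_schedule_farUV` supplies — for every block size `b ≥ 11` and every
POSITIVE threshold schedule — weights `θ, δ` satisfying ALL of these clauses EXCEPT the summability (with `β₁ = 1`, any `N`), so that a closer of such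
a stub is left with exactly the β-uniform summability of `θ β k = δ(𝔟, ε β k, k, β)^{1/16}` over the levels `k ≤ kmax β R` — the located open
content (far-UV: free for `b^{4k} ≲ β/log β`; the characteristic scales need Bałaban's R-operation).
HONEST FRAMING: bookkeeping over p563207; nothing of E0′; not a gap, not Clay.
-/

set_option autoImplicit false

noncomputable section

open MeasureTheory Filter Topology Finset
open Literature.MathematicalPhysics.QuantumLattice

namespace Summit.QuantumFields.YangMills.Cruxes.UVSeamRec.PolymerRarity

open Summit.QuantumFields.YangMills.Cruxes.OSLegsFromFemtoAndGap.DlrCollarTransfer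
open Summit.QuantumFields.YangMills.Cruxes.UVSeamRec.PolymerData

variable {N : ℕ} [NeZero N]

/-- **THE FAR-UV WINDOW CELL LAWS IN SCHEDULE LETTERS.**  For every block size `b ≥ 11` and every positive threshold schedule `ε β k > 0` there
are weights `θ δ : ℝ → ℕ → ℝ` with `0 ≤ θ ≤ 1`, `0 ≤ δ ≤ θ¹⁶` (indeed `δ = θ¹⁶`) such that for every `β ≥ 1`, every odd torus (`L ≥ 1`), every level
`k ≥ 1`, every window origin `o` and every finite level-`k` family `A` whose blocks fit in `[o, o+2L+1)⁴`:
`⟨∏_{γ∈A} 1_{largeFieldEvent 𝔟 (ε β k) γ}∘lift⟩_{2L+1,β} ≤ ∏_{γ∈A} δ β k` — the window-cell-law conjuncts of a `stub_backgroundFieldWCL`-shaped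
binder, leaving only the summability `Σ_{1≤k≤kmax β R} θ β k ≤ D` (open beyond the far UV).  From `windowCellLaws_inhabited_farUV` with
`θ β k := δ(𝔟, ε β k, k, β)^{1/16}`. [cite: Balaban1985Averaging, Prop. 2 (52)–(54) p.26] -/
theorem windowCellLaws_schedule_farUV (𝔟 : BlockSize) (hb : 11 ≤ 𝔟.b) (ε : ℝ → ℕ → ℝ) (hε : ∀ β k, 0 < ε β k) :
    ∃ θ δ : ℝ → ℕ → ℝ,
      (∀ β k, 0 ≤ θ β k) ∧ (∀ β k, θ β k ≤ 1) ∧ (∀ β k, 0 ≤ δ β k) ∧ (∀ β k, δ β k ≤ θ β k ^ 16) ∧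
      ∀ β : ℝ, 1 ≤ β → ∀ L : ℕ, 1 ≤ L → ∀ k : ℕ, 1 ≤ k → ∀ (o : Fin 4 → ℤ) (A : Finset Polymer),
        (∀ γ ∈ A, γ.k = k) → (∀ γ ∈ A, ∀ c, o c ≤ anchor 𝔟 γ c ∧ anchor 𝔟 γ c + (𝔟.b : ℤ) ^ k ≤ o c + (2 * L + 1)) →
        torusE (Matrix.specialUnitaryGroup (Fin N) ℂ) (fundamentalLatticeRep N) β L (fun U => ∏ γ ∈ A,
          (largeFieldEvent (N := N) 𝔟 (ε β k) γ).indicator (fun _ => (1 : ℝ)) U) ≤ ∏ _γ ∈ A, δ β k := by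
  obtain ⟨d, hd01, -, hlaw⟩ := windowCellLaws_inhabited_farUV (N := N)
  refine ⟨fun β k => (d 𝔟 (ε β k) k β) ^ ((1 : ℝ) / 16), fun β k => d 𝔟 (ε β k) k β,
    fun β k => Real.rpow_nonneg (hd01 𝔟 (ε β k) k β).1 _,
    fun β k => Real.rpow_le_one (hd01 𝔟 (ε β k) k β).1 (hd01 𝔟 (ε β k) k β).2 (by norm_num),
    fun β k => (hd01 𝔟 (ε β k) k β).1, fun β k => le_of_eq ?_,
    fun β hβ L hL k _ o A hA hwin => hlaw 𝔟 hb (ε β k) (hε β k) L hL β hβ k o A hA hwin⟩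
  -- `δ = (δ^{1/16})^16`
  rw [← Real.rpow_natCast ((d 𝔟 (ε β k) k β) ^ ((1 : ℝ) / 16)) 16, ← Real.rpow_mul (hd01 𝔟 (ε β k) k β).1]
  norm_num

end Summit.QuantumFields.YangMills.Cruxes.UVSeamRec.PolymerRarity

end
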